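import Summits.AtomisticToContinuum.FouriersLaw.Theorems.LatticeLandauDampingAbelThermodynamicLimitOffsetMatchingOfEngines

/-!
# Stub `stub_bulkAnchorMatchingOfDynamicalMatching` (F1′) of line `drude-controls-conductance` (R2b) — crux
`JunctionLocality.NonBallistic` (stmt-AtomisticToContinuum-9127): ANCHOR-UNIFORM FIXED-TIME PER-OFFSET MATCHING in the
bulk

Helper file (`--supports stmt-AtomisticToContinuum-9127`) proving the registered stub
`stub_bulkAnchorMatchingOfDynamicalMatching` VERBATIM (an implication `(F1a) → (F1)`); nothing here closes the item.

For `P = pinnedChain ω₂ lam β γ` (all `> 0`), `T > 0` and an admissible infinite-volume pair `(μ, D)` (shift-invariant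
DLR state `μ` at temperature `T`; dynamics `D` with `carrier ⊆ bmGood`, preserving `μ`, absolutely convergent current
correlations), every offset `x`, time `t ≥ 0` and `ε > 0` admit `L, N₀` with
`|⟨j_a(0) j_{a+x}(t)⟩_{N,T} - ∫ j_0 (j_x ∘ φ_t) dμ| ≤ ε` for all `N ≥ N₀` and all anchors `a` with `L ≤ a`, `a + L < N`.

Route. The shift-invariant DLR state is BM-superstable
(`hasSuperstabilityEstimate_of_isShiftInvariant_pinnedChain`), so `(μ, D)` is a regular witness, and the conclusion is
the anchor-uniform two-dynamics coupling of the sibling line `series-law-at-every-laplace-frequency`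
(`stub_uniformFixedTimeOffsetMatchingOfEngines`, file `LatticeLandauDampingAbelThermodynamicLimitOffsetMatchingOfEngines`)
applied to its two LANDED engines — (E1) `stub_bulkWindowEquivalence` (anchor-uniform bulk equivalence of ensembles on
bounded window observables; the static half) and (M1sev) `stub_openChainSeveredLocality` (`N`-uniform `L²` locality of
the open chain against LLL's severed flow; the dynamic half) — here re-run for `t ≥ 0` (the landed coupling is stated for
`t > 0`; (M1sev) is a statement on `t ∈ [0, τ]`, so the same five `ε/8`-steps go through at `t = 0`):
(1) (M1sev) + Cauchy–Schwarz against the `N`-uniform `L²` norm of `j_i`; (2) two-level truncation on the open chain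
(`N`-uniform fourth moments `pinnedChain_contactCurrentFourthMoment`); (3) (E1) on the one window observable
`pinnedChain_windowObservable`; (4) severed bond windows recover `D.flow` under `μ`
(`tendsto_integral_clamp_bondCurrentZ_severedFlow_bondWindow`); (5) untruncation under `μ`. The bulk anchors `L ≤ a`,
`a + L < N` with `L ≥ |x|` put the registered `dite` in its `then` branch. The dynamical hypothesis (F1a) of the
implication is carried, not used (the (M1sev) engine is its `L²` form).

All statements proved; `[folklore]`. No definitions.
-/

noncomputable section

namespace Summit.AtomisticToContinuum.FouriersLaw.Theorems.NonBallistic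

open MeasureTheory ProbabilityTheory Set Filter Topology Function
open scoped NNReal ENNReal
open Literature.MathematicalPhysics.KineticTheory Literature.MathematicalPhysics.KineticTheory.HeatConduction
open Literature.Probability.Process OscillatorChain
open Literature.Analysis.FunctionSpaces (abs_max_neg_min_le)
open Summit.AtomisticToContinuum.FouriersLaw.Theorems.SubdiffusiveBondHeat (pinnedChain_integral_sq_act_le)
open Summit.AtomisticToContinuum.FouriersLaw.Theorems.LightConeBondHeat (pinnedChain_abs_bondCurrent_le_exp
  quarter_inv_temp_admissible)
open Summit.AtomisticToContinuum.FouriersLaw.Theorems.AbelThermodynamicLimit.LoomisCompactHorizonWitness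
  (continuous_clamp pinnedChain_integral_sq_bondCurrent_gibbsMeasure_le)
open Summit.AtomisticToContinuum.FouriersLaw.Theorems.AbelThermodynamicLimit.SeriesLawAtEveryLaplaceFrequency
  (stub_bulkWindowEquivalence stub_openChainSeveredLocality pinnedChain_windowObservable)
open Summit.AtomisticToContinuum.FouriersLaw.Theorems.AbelThermodynamicLimit.SeriesLawAtEveryLaplaceFrequency.OffsetMatching

/-- **Anchor-uniform per-offset fixed-time open/closed matching at every `t ≥ 0`** for a regular witness `(μT, D)`:
`|⟨j_i(0) j_k(t)⟩_{N,T} - ∫ j_0 (j_x ∘ φ_t) dμT| ≤ ε` for `N ≥ N₀`, all `L`-deep anchors `i` and `k = i + x`. The proof of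
`stub_uniformFixedTimeOffsetMatchingOfEngines` (line `series-law-at-every-laplace-frequency`) on the landed engines
`stub_bulkWindowEquivalence` / `stub_openChainSeveredLocality`, with the horizon `t + 1` so that `t = 0` is allowed.
[folklore] -/
theorem uniformFixedTimeOffsetMatching_of_nonneg {ω₂ lam β γ : ℝ} (hω : 0 < ω₂) (hl : 0 < lam) (hβ : 0 < β)
    (hγ : 0 < γ) {T : ℝ} (hT : 0 < T) {μT : Measure ChainConfig} (D : InfiniteChainDynamics (pinnedChain ω₂ lam β γ))
    (hG : (pinnedChain ω₂ lam β γ).IsChainGibbsMeasure T μT) (hS : IsShiftInvariant μT)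
    (hss : (pinnedChain ω₂ lam β γ).HasSuperstabilityEstimate μT)
    (hcar : D.carrier ⊆ (pinnedChain ω₂ lam β γ).bmGood) (hPres : D.PreservesMeasure μT)
    (hAC : ∀ t : ℝ, D.HasAbsConvergentCorrelation μT t) (x : ℤ) {t : ℝ} (ht : 0 ≤ t) {ε : ℝ} (hε : 0 < ε) :
    ∃ L N₀ : ℕ, ∀ N : ℕ, N₀ ≤ N → ∀ i k : Fin N, L ≤ i.val → i.val + L < N → (k.val : ℤ) = i.val + x →
      |(∫ z, (pinnedChain ω₂ lam β γ).bondCurrent N i z *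
          (∫ y, (pinnedChain ω₂ lam β γ).bondCurrent N k y
            ∂((pinnedChain ω₂ lam β γ).transitionKernel N T T t.toNNReal z))
          ∂((pinnedChain ω₂ lam β γ).gibbsMeasure N T)) -
        ∫ σ, (pinnedChain ω₂ lam β γ).bondCurrentZ σ 0 *
          (pinnedChain ω₂ lam β γ).bondCurrentZ (D.flow t σ) x ∂μT| ≤ ε := by
  /- ### constants -/
  haveI hμT : IsProbabilityMeasure μT := hG.isProbabilityMeasure
  set hB1 : (pinnedChain ω₂ lam β γ).CondB1 := condB1_pinnedChain hω.le hl.le hβ.le γ with hB1def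
  have hU2 : ContDiff ℝ 2 (pinnedChain ω₂ lam β γ).U := (pinnedChain_isEvenPolyOfDegree_U β γ hω.le hl).contDiff_two
  have hV2 : ContDiff ℝ 2 (pinnedChain ω₂ lam β γ).V := (pinnedChain_isEvenPolyOfDegree_V ω₂ lam γ hβ).contDiff_two
  haveI hμN : ∀ N : ℕ, IsProbabilityMeasure ((pinnedChain ω₂ lam β γ).gibbsMeasure N T) := fun N =>
    pinnedChain_isProbabilityMeasure_gibbsMeasure hω hl.le hβ.le γ N hT
  obtain ⟨hϑ0, h2ϑ⟩ := quarter_inv_temp_admissible hT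
  -- `N`-uniform second and fourth moments of the bond currents under `μ_{N,T}`
  obtain ⟨C₂, hC₂⟩ := pinnedChain_integral_sq_bondCurrent_gibbsMeasure_le (γ := γ) hω hl hβ hT
  have hC₂0 : 0 ≤ C₂ := (integral_nonneg fun z => sq_nonneg _).trans (hC₂ 1 ⟨0, one_pos⟩)
  obtain ⟨C₄, hC₄0, hC₄⟩ := pinnedChain_contactCurrentFourthMoment ω₂ lam β γ hω hl.le hβ.le T hT
  -- moments under `μT`
  have hj4 : ∀ y : ℤ, Integrable (fun σ => (pinnedChain ω₂ lam β γ).bondCurrentZ σ y ^ 4) μT := by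
    intro y
    have h := (memLp_bondCurrentZ_pinnedChain γ hω.le hl.le hβ hss y (p := ((4 : ℕ) : ℝ≥0∞))
      (by simp)).integrable_norm_pow'
    refine h.congr (Eventually.of_forall fun σ => ?_)
    simp only [Real.norm_eq_abs, pow_abs]
    exact abs_of_nonneg (by positivity)
  have hj2 : ∀ y : ℤ, MemLp (fun σ => (pinnedChain ω₂ lam β γ).bondCurrentZ σ y) 2 μT := fun y =>
    memLp_bondCurrentZ_pinnedChain γ hω.le hl.le hβ hss y (by simp)
  set m₄ : ℝ := ∫ σ, (pinnedChain ω₂ lam β γ).bondCurrentZ σ 0 ^ 4 ∂μT with hm₄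
  set m₂ : ℝ := ∫ σ, (pinnedChain ω₂ lam β γ).bondCurrentZ σ x ^ 2 ∂μT with hm₂
  have hm₂0 : 0 ≤ m₂ := integral_nonneg fun σ => sq_nonneg _
  set C₂' : ℝ := 2 * C₂ + 2 with hC₂'
  have hC₂'0 : 0 ≤ C₂' := by rw [hC₂']; positivity
  /- ### tolerances -/
  obtain ⟨A, B, hA0, hB0, hABN, hABT⟩ := exists_truncation_levels C₄ m₄ hε hC₂'0 hm₂0
  obtain ⟨hεA0, hεA1, hεAC⟩ := sqrt_mul_sqrt_tolerance_le hC₂0 hε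
  set εA : ℝ := min 1 ((ε / 8) ^ 2 / (C₂ + 1)) with hεA
  -- (M1sev) at horizon `t`
  obtain ⟨M₀, hM₀⟩ := stub_openChainSeveredLocality ω₂ lam β γ hω hl hβ hγ T hT (t + 1) (by linarith) εA hεA0
  -- the severed bond windows recover `D.flow` on the clamped pairing (part 1)
  have hsev := tendsto_integral_clamp_bondCurrentZ_severedFlow_bondWindow hω hl hβ hB1 (μT := μT) D hcar hPres t x
    hA0.le hB0.le
  obtain ⟨M₁, hM₁⟩ := Metric.tendsto_atTop.1 hsev (ε / 8) (by positivity)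
  -- fix the window margin `M`
  set M : ℕ := max M₀ M₁ with hMdef
  obtain ⟨NA, hNA⟩ := hM₀ M (le_max_left _ _)
  have h34 := hM₁ M (le_max_right _ _)
  rw [Real.dist_eq] at h34
  -- the window observable (part 2)
  have hgAm : Measurable fun r : ℝ => max (-A) (min A r) / A := (continuous_clamp A).measurable.div_const A
  have hgBm : Measurable fun r : ℝ => max (-B) (min B r) / B := (continuous_clamp B).measurable.div_const B
  obtain ⟨a, hax⟩ : ∃ a : ℕ, (M : ℤ) + 1 - x ≤ a := ⟨(M + 1 - x).toNat, by omega⟩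
  obtain ⟨b, hb1, hbx⟩ : ∃ b : ℕ, 1 ≤ b ∧ x + M + 2 ≤ (b : ℤ) := ⟨(x + M + 2).toNat + 1, by omega, by omega⟩
  obtain ⟨f, hfm, hfrs, hfinf, hffin⟩ :=
    pinnedChain_windowObservable ω₂ lam β γ hω hl hβ hB1 _ _ hgAm hgBm x M t a b hax hb1 hbx
  have hfbd : ∀ w, |f w| ≤ 1 := by
    intro w
    obtain ⟨r, r', e⟩ := hfrs w
    rw [e, abs_mul]
    have h1 : |max (-A) (min A r) / A| ≤ 1 := by
      rw [abs_div, abs_of_pos hA0, div_le_one hA0]; exact abs_max_neg_min_le hA0.le r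
    have h2 : |max (-B) (min B r') / B| ≤ 1 := by
      rw [abs_div, abs_of_pos hB0, div_le_one hB0]; exact abs_max_neg_min_le hB0.le r'
    exact mul_le_one₀ h1 (abs_nonneg _) h2
  -- (E1) on the window observable
  have hAB : 0 < A * B := mul_pos hA0 hB0
  obtain ⟨LE, NE, hNE⟩ := stub_bulkWindowEquivalence ω₂ lam β γ hω hl hβ hγ T hT μT hG hS hss (a + b) f hfm hfbd
    (ε / 8 / (A * B))
    (by positivity)
  /- ### the thresholds -/
  refine ⟨LE + a + b + 2 * M + x.natAbs + 5, max (max NA NE) 1, fun N hN i k hLi hiL hk => ?_⟩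
  have hNA' : NA ≤ N := le_trans (le_trans (le_max_left _ _) (le_max_left _ _)) hN
  have hNE' : NE ≤ N := le_trans (le_trans (le_max_right _ _) (le_max_left _ _)) hN
  have hN0 : 0 < N := lt_of_lt_of_le one_pos (le_trans (le_max_right _ _) hN)
  have hai : a ≤ i.val := by omega
  have hib : i.val + b < N := by omega
  have hkM : M + 2 ≤ k.val := by omega
  have hkN : k.val + M + 3 < N := by omega
  set i₀ : Fin N := ⟨i.val - a, by omega⟩ with hi₀
  have h₀ : i₀.val + a = i.val := by show i.val - a + a = i.val; omega
  have hLE1 : LE ≤ i₀.val := by show LE ≤ i.val - a; omega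
  have hLE2 : i₀.val + (a + b) + LE < N := by show i.val - a + (a + b) + LE < N; omega
  /- ### the objects on the open chain -/
  set μN := (pinnedChain ω₂ lam β γ).gibbsMeasure N T with hμNdef
  set ι : PhaseSpace N → ChainConfig := fun z y =>
    if h : 0 ≤ y ∧ y < N then (z.1 ⟨y.toNat, by omega⟩, z.2 ⟨y.toNat, by omega⟩) else (0, 0) with hι
  have hιm : Measurable ι := measurable_diteEmbed N
  set u : PhaseSpace N → ℝ := fun z => (pinnedChain ω₂ lam β γ).bondCurrent N i z with hu
  set v : PhaseSpace N → ℝ := fun z => ∫ y, (pinnedChain ω₂ lam β γ).bondCurrent N k y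
    ∂((pinnedChain ω₂ lam β γ).transitionKernel N T T t.toNNReal z) with hv
  set w : PhaseSpace N → ℝ := fun z => (pinnedChain ω₂ lam β γ).bondCurrentZ
    (severedFlow hB1 (Finset.Icc ((k.val : ℤ) - M) ((k.val : ℤ) + 1 + M)) t (ι z)) (k.val : ℤ) with hw
  -- measurability
  have hum : Measurable u := (pinnedChain_continuous_bondCurrent ω₂ lam β γ N i).measurable
  have hvm : AEStronglyMeasurable v μN :=
    ((pinnedChain_continuous_bondCurrent ω₂ lam β γ N k).stronglyMeasurable.integral_kernel
      (κ := (pinnedChain ω₂ lam β γ).transitionKernel N T T t.toNNReal)).aestronglyMeasurable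
  have hwm : Measurable w :=
    (measurable_bondCurrentZ _ _).comp ((measurable_severedFlow hB1 _ hU2 hV2 t).comp hιm)
  -- square integrability
  have hsqi := pinnedChain_integral_sq_act_le hω hl.le hβ hγ hN0 hT hϑ0 h2ϑ
    (pinnedChain_continuous_bondCurrent ω₂ lam β γ N i) (pinnedChain_abs_bondCurrent_le_exp hω.le hl.le hβ.le γ N hϑ0 i)
    t.toNNReal
  have hsqk := pinnedChain_integral_sq_act_le hω hl.le hβ hγ hN0 hT hϑ0 h2ϑ
    (pinnedChain_continuous_bondCurrent ω₂ lam β γ N k) (pinnedChain_abs_bondCurrent_le_exp hω.le hl.le hβ.le γ N hϑ0 k)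
    t.toNNReal
  have hu2 : MemLp u 2 μN := (memLp_two_iff_integrable_sq hum.aestronglyMeasurable).2 hsqi.1
  have hv2int : Integrable (fun z => v z ^ 2) μN := hsqk.2.1
  have hv2 : MemLp v 2 μN := (memLp_two_iff_integrable_sq hvm).2 hv2int
  have hv2le : ∫ z, v z ^ 2 ∂μN ≤ C₂ := hsqk.2.2.trans (hC₂ N k)
  -- (M1sev) at `(M, N, k, t)`
  obtain ⟨hYint, hYle⟩ := hNA N hNA' k hkM hkN t ⟨ht, by linarith⟩
  have hYint' : Integrable (fun z => (v z - w z) ^ 2) μN := hYint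
  have hYle' : ∫ z, (v z - w z) ^ 2 ∂μN ≤ εA := hYle
  have hvw2 : MemLp (fun z => v z - w z) 2 μN := (memLp_two_iff_integrable_sq (hvm.sub hwm.aestronglyMeasurable)).2 hYint'
  have hw2 : MemLp w 2 μN := (hv2.sub hvw2).ae_eq (Eventually.of_forall fun z => by simp)
  have hw2int : Integrable (fun z => w z ^ 2) μN := hw2.integrable_sq
  have hw2le : ∫ z, w z ^ 2 ∂μN ≤ C₂' :=
    calc ∫ z, w z ^ 2 ∂μN ≤ 2 * (∫ z, v z ^ 2 ∂μN) + 2 * ∫ z, (v z - w z) ^ 2 ∂μN :=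
          integral_sq_le_two_mul_add μN hv2int hYint' hw2int
      _ ≤ 2 * C₂ + 2 * 1 := by gcongr; exact hYle'.trans hεA1
      _ = C₂' := by rw [hC₂']; ring
  have huv : Integrable (fun z => u z * v z) μN := hu2.integrable_mul hv2
  have huw : Integrable (fun z => u z * w z) μN := hu2.integrable_mul hw2
  /- ### Step 1: (M1sev) + Cauchy–Schwarz -/
  have h01 : |(∫ z, u z * v z ∂μN) - ∫ z, u z * w z ∂μN| ≤ ε / 8 := by
    have e : (∫ z, u z * v z ∂μN) - ∫ z, u z * w z ∂μN = ∫ z, u z * (v z - w z) ∂μN := by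
      rw [← integral_sub huv huw]
      exact integral_congr_ae (Eventually.of_forall fun z => by ring)
    rw [e]
    calc |∫ z, u z * (v z - w z) ∂μN| ≤ Real.sqrt (∫ z, u z ^ 2 ∂μN) * Real.sqrt (∫ z, (v z - w z) ^ 2 ∂μN) :=
          abs_integral_mul_le_sqrt_integral_sq_mul hu2 hvw2
      _ ≤ Real.sqrt C₂ * Real.sqrt εA :=
          mul_le_mul (Real.sqrt_le_sqrt (hC₂ N i)) (Real.sqrt_le_sqrt hYle') (Real.sqrt_nonneg _)
            (Real.sqrt_nonneg _)
      _ ≤ ε / 8 := hεAC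
  /- ### Step 2: two-level truncation on the open chain -/
  have h12 : |(∫ z, u z * w z ∂μN) - ∫ z, max (-A) (min A (u z)) * max (-B) (min B (w z)) ∂μN| ≤ ε / 8 := by
    refine (abs_integral_mul_sub_integral_clamp_two_le μN hum hwm huw (hC₄ N i).1 hw2int hA0 hB0).trans ?_
    refine le_trans ?_ hABN
    have h1 : Real.sqrt (∫ z, u z ^ 4 ∂μN) ≤ Real.sqrt C₄ := Real.sqrt_le_sqrt (hC₄ N i).2
    have h2 : Real.sqrt (∫ z, w z ^ 2 ∂μN) ≤ Real.sqrt C₂' := Real.sqrt_le_sqrt hw2le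
    exact add_le_add (div_le_div_of_nonneg_right (mul_le_mul h1 h2 (Real.sqrt_nonneg _) (Real.sqrt_nonneg _)) hA0.le)
      (div_le_div_of_nonneg_right (mul_le_mul_of_nonneg_left hw2le hA0.le) hB0.le)
  /- ### Step 3: (E1) on the window observable -/
  have h23 : |(∫ z, max (-A) (min A (u z)) * max (-B) (min B (w z)) ∂μN) -
      ∫ σ, max (-A) (min A ((pinnedChain ω₂ lam β γ).bondCurrentZ σ 0)) *
        max (-B) (min B ((pinnedChain ω₂ lam β γ).bondCurrentZ
          (severedFlow hB1 (Finset.Icc (x - M) (x + 1 + M)) t σ) x)) ∂μT| ≤ ε / 8 := by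
    have hE := hNE N hNE' i₀ hLE1 hLE2
    -- the open-chain integrand
    have e1 : ∫ z, f (fun j : Fin (a + b + 1) => z.1 ⟨i₀.val + j.val, by omega⟩,
        fun j : Fin (a + b + 1) => z.2 ⟨i₀.val + j.val, by omega⟩) ∂μN =
        (∫ z, max (-A) (min A (u z)) * max (-B) (min B (w z)) ∂μN) / (A * B) := by
      rw [← integral_div]
      refine integral_congr_ae (Eventually.of_forall fun z => ?_)
      dsimp only
      rw [hffin N i₀ i k h₀ hib hk z]
      ring
    -- the infinite-chain integrand
    have e2 : ∫ σ, f (boxPhaseAt 0 (a + b) σ) ∂μT =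
        (∫ σ, max (-A) (min A ((pinnedChain ω₂ lam β γ).bondCurrentZ σ 0)) *
          max (-B) (min B ((pinnedChain ω₂ lam β γ).bondCurrentZ
            (severedFlow hB1 (Finset.Icc (x - M) (x + 1 + M)) t σ) x)) ∂μT) / (A * B) := by
      rw [hfinf μT hS, ← integral_div]
      refine integral_congr_ae (Eventually.of_forall fun σ => ?_)
      dsimp only
      ring
    rw [e1, e2, ← sub_div, abs_div, abs_of_pos hAB, div_le_div_iff_of_pos_right hAB] at hE
    exact hE
  /- ### Step 5: untruncation under `μT` -/
  have h45 : |(∫ σ, max (-A) (min A ((pinnedChain ω₂ lam β γ).bondCurrentZ σ 0)) *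
        max (-B) (min B ((pinnedChain ω₂ lam β γ).bondCurrentZ (D.flow t σ) x)) ∂μT) -
      ∫ σ, (pinnedChain ω₂ lam β γ).bondCurrentZ σ 0 * (pinnedChain ω₂ lam β γ).bondCurrentZ (D.flow t σ) x ∂μT| ≤
      ε / 8 := by
    rw [abs_sub_comm]
    have hwm' : Measurable fun σ => (pinnedChain ω₂ lam β γ).bondCurrentZ (D.flow t σ) x :=
      (measurable_bondCurrentZ _ x).comp (hPres.2 t).measurable
    have hw2' : Integrable (fun σ => (pinnedChain ω₂ lam β γ).bondCurrentZ (D.flow t σ) x ^ 2) μT :=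
      ((hj2 x).comp_measurePreserving (hPres.2 t)).integrable_sq
    have ew : ∫ σ, (pinnedChain ω₂ lam β γ).bondCurrentZ (D.flow t σ) x ^ 2 ∂μT = m₂ :=
      integral_sq_comp_eq' (hPres.2 t) (measurable_bondCurrentZ _ x)
    refine (abs_integral_mul_sub_integral_clamp_two_le μT (measurable_bondCurrentZ _ 0) hwm' ((hAC t).1 x) (hj4 0)
      hw2' hA0 hB0).trans ?_
    rw [ew]
    exact hABT
  /- ### assembly -/
  have t1 := abs_sub_le (∫ z, u z * v z ∂μN) (∫ z, u z * w z ∂μN)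
    (∫ σ, (pinnedChain ω₂ lam β γ).bondCurrentZ σ 0 * (pinnedChain ω₂ lam β γ).bondCurrentZ (D.flow t σ) x ∂μT)
  have t2 := abs_sub_le (∫ z, u z * w z ∂μN) (∫ z, max (-A) (min A (u z)) * max (-B) (min B (w z)) ∂μN)
    (∫ σ, (pinnedChain ω₂ lam β γ).bondCurrentZ σ 0 * (pinnedChain ω₂ lam β γ).bondCurrentZ (D.flow t σ) x ∂μT)
  have t3 := abs_sub_le (∫ z, max (-A) (min A (u z)) * max (-B) (min B (w z)) ∂μN)
    (∫ σ, max (-A) (min A ((pinnedChain ω₂ lam β γ).bondCurrentZ σ 0)) *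
      max (-B) (min B ((pinnedChain ω₂ lam β γ).bondCurrentZ
        (severedFlow hB1 (Finset.Icc (x - M) (x + 1 + M)) t σ) x)) ∂μT)
    (∫ σ, (pinnedChain ω₂ lam β γ).bondCurrentZ σ 0 * (pinnedChain ω₂ lam β γ).bondCurrentZ (D.flow t σ) x ∂μT)
  have t4 := abs_sub_le (∫ σ, max (-A) (min A ((pinnedChain ω₂ lam β γ).bondCurrentZ σ 0)) *
      max (-B) (min B ((pinnedChain ω₂ lam β γ).bondCurrentZ
        (severedFlow hB1 (Finset.Icc (x - M) (x + 1 + M)) t σ) x)) ∂μT)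
    (∫ σ, max (-A) (min A ((pinnedChain ω₂ lam β γ).bondCurrentZ σ 0)) *
      max (-B) (min B ((pinnedChain ω₂ lam β γ).bondCurrentZ (D.flow t σ) x)) ∂μT)
    (∫ σ, (pinnedChain ω₂ lam β γ).bondCurrentZ σ 0 * (pinnedChain ω₂ lam β γ).bondCurrentZ (D.flow t σ) x ∂μT)
  show |(∫ z, u z * v z ∂μN) -
    ∫ σ, (pinnedChain ω₂ lam β γ).bondCurrentZ σ 0 * (pinnedChain ω₂ lam β γ).bondCurrentZ (D.flow t σ) x ∂μT| ≤ ε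
  linarith

/-- **Registered stub `stub_bulkAnchorMatchingOfDynamicalMatching`** (F1′, stub 14 of line `drude-controls-conductance`,
R2b): (F1a) ⇒ ANCHOR-UNIFORM FIXED-TIME PER-OFFSET MATCHING in the bulk — for every admissible pair `(μ, D)`,
offset `x`, time `t ≥ 0` and `ε > 0` there are `L, N₀` with
`|⟨j_a(0) j_{a+x}(t)⟩_{N,T} - ∫ j_0 (j_x ∘ φ_t) dμ| ≤ ε` for all `N ≥ N₀` and all anchors `a` with `L ≤ a`, `a + L < N`
(see the module docstring: superstability of the shift-invariant DLR state + `uniformFixedTimeOffsetMatching_of_nonneg`;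
the hypothesis (F1a) is carried). [folklore] -/
theorem stub_bulkAnchorMatchingOfDynamicalMatching :
    (∀ ω₂ lam β γ : ℝ, 0 < ω₂ → 0 < lam → 0 < β → 0 < γ → ∀ T : ℝ, 0 < T →
          ∀ (hB1 : (pinnedChain ω₂ lam β γ).CondB1)
            (ι : (N : ℕ) → ℕ → PhaseSpace N → ChainConfig),
            (∀ (N a : ℕ) (z : PhaseSpace N) (i : ℤ),
              ι N a z i = if h : 0 ≤ i + (a : ℤ) ∧ i + (a : ℤ) < N then
                (z.1 ⟨(i + (a : ℤ)).toNat, by omega⟩, z.2 ⟨(i + (a : ℤ)).toNat, by omega⟩)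
                else (0, 0)) →
          ∀ (t : ℝ), 0 ≤ t → ∀ (x : ℤ) (ε : ℝ), 0 < ε → ∃ R₀ : ℕ, ∀ R : ℕ, R₀ ≤ R →
            ∀ N a : ℕ, R + 1 ≤ a → a + R + 3 ≤ N →
            (((pinnedChain ω₂ lam β γ).gibbsMeasure N T).prod wienerPair)
              {q : PhaseSpace N × WienerPair |
                ε < |(pinnedChain ω₂ lam β γ).bondCurrentZ
                      (ι N a ((pinnedChain ω₂ lam β γ).solMap N T T t q.1 (pairPath q.2))) x -
                    (pinnedChain ω₂ lam β γ).bondCurrentZ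
                      (OscillatorChain.severedFlow hB1 (Finset.Icc (-(R : ℤ)) R) t (ι N a q.1)) x|} ≤ ENNReal.ofReal ε) →
    ∀ ω₂ lam β γ : ℝ, 0 < ω₂ → 0 < lam → 0 < β → 0 < γ → ∀ T : ℝ, 0 < T →
          ∀ (μ : Measure ChainConfig) (D : InfiniteChainDynamics (pinnedChain ω₂ lam β γ)),
            (pinnedChain ω₂ lam β γ).IsChainGibbsMeasure T μ → IsShiftInvariant μ →
            D.carrier ⊆ (pinnedChain ω₂ lam β γ).bmGood → D.PreservesMeasure μ →
            (∀ t : ℝ, D.HasAbsConvergentCorrelation μ t) →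
            ∀ (x : ℤ) (t : ℝ), 0 ≤ t → ∀ ε : ℝ, 0 < ε → ∃ L N₀ : ℕ, ∀ N : ℕ, N₀ ≤ N →
              ∀ a : ℕ, L ≤ a → a + L < N →
              |(if h : 0 ≤ (a : ℤ) + x ∧ (a : ℤ) + x < N ∧ a < N then
                  ∫ z, (pinnedChain ω₂ lam β γ).bondCurrent N ⟨a, h.2.2⟩ z *
                    (∫ y, (pinnedChain ω₂ lam β γ).bondCurrent N ⟨((a : ℤ) + x).toNat, by omega⟩ y
                      ∂((pinnedChain ω₂ lam β γ).transitionKernel N T T t.toNNReal z))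
                    ∂((pinnedChain ω₂ lam β γ).gibbsMeasure N T)
                else 0) -
                ∫ σ, (pinnedChain ω₂ lam β γ).bondCurrentZ σ 0 * (pinnedChain ω₂ lam β γ).bondCurrentZ (D.flow t σ) x ∂μ| ≤ ε := by
  intro _hF1a ω₂ lam β γ hω hl hβ hγ T hT μ D hG hS hcar hPres hAC x t ht ε hε
  have hss : (pinnedChain ω₂ lam β γ).HasSuperstabilityEstimate μ :=
    hasSuperstabilityEstimate_of_isShiftInvariant_pinnedChain γ hω hl.le hβ.le hT hG hS
  obtain ⟨L, N₀, h⟩ :=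
    uniformFixedTimeOffsetMatching_of_nonneg hω hl hβ hγ hT D hG hS hss hcar hPres hAC x ht hε
  refine ⟨L + x.natAbs, N₀, fun N hN a hLa haL => ?_⟩
  have h1 : 0 ≤ (a : ℤ) + x ∧ (a : ℤ) + x < N ∧ a < N := ⟨by omega, by omega, by omega⟩
  rw [dif_pos h1]
  exact h N hN ⟨a, h1.2.2⟩ ⟨((a : ℤ) + x).toNat, by omega⟩ (by dsimp only; omega) (by dsimp only; omega)
    (by dsimp only; omega)

end Summit.AtomisticToContinuum.FouriersLaw.Theorems.NonBallistic

end
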